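import Summits.ResolutionOfSingularities.ResolutionOfSingularities.Theorems.RisoCentresResolve.Negative.RisoCentresResolveBddLettersRtd
import Summits.ResolutionOfSingularities.ResolutionOfSingularities.Theorems.RisoCentresResolve.Negative.RisoCentresResolveBddLettersInert

/-!
# Crux `RisoCentresResolve` (stmt-ResolutionOfSingularities-18546) — the CUT LEVELS of the schedule are
# load-bearing: letters below the dimension of an equisingular family are inert, so the letters of a
# resolving schedule cannot be bounded in advance and no single schedule serves all presentations

Route `ResolutionOfSingularities/RisoStrata`, crux `RisoCentresResolve` (Monreal Q1.6 in characteristic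
`p`, `∃`-schedule form).  The crux asks, for EVERY projective presentation, for SOME finite schedule
`(d₁,…,d_m)` of riso-cut blow-ups (the `t`-th centre is `Cen_{d_t}` = the intersection of the SINGULAR
maximal ideals of riso-triviality dimension `≤ d_t`) resolving every valuative local ring.  Two negative
lemmas on the quantifier structure, both kernel-checked with the crux's `let`-definitions VERBATIM:

* `risoCentresResolve_false_with_bounded_letters` — the crux with `∃ sched` weakened to
  "`∃ sched` all of whose letters are `≤ D`", for a bound `D` chosen BEFORE the presentation
  (`∃ D, ∀ presentation, ∃ sched ≤ D, …`), is FALSE.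
* `risoCentresResolve_false_with_fixed_schedule s` — for every fixed `s : List ℕ`, the crux with
  `∃ sched : List ℕ,` replaced by `let sched : List ℕ := s;` is FALSE (no universal word; the case
  `s = []` is `risoCentresResolve_false_without_blowups`).

Witness (for a bound `D`): `k = 𝔽₂^alg`, `K = k'(T)` with `k' = Frac k[z₀,…,z_D]`, `N = D + 3`,
`h = (1, T², T³, z₀, …, z_D)` — the product `cusp × 𝔸^{D+1}`; chart `j = 0`, `B₀ = k[T², T³, z]`.
MECHANISM (the informative part, `bddLetters_rtd`): the typed riso-triviality dimension is `≥ D + 1`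
at EVERY closed point of `B₀` — generators shifted into the point, `W` = the `D+1` coordinate directions
of the factor `𝔸^{D+1}`, the IDENTITY straightener `φ a i = a (g i)`, and translated arcs obtained by
re-evaluating the polynomial presentation `k[x, z] ⊇ B₀` at `(x, a z + w)` with `x² = a T², x³ = a T³`.
Hence for every letter `d ≤ D` the filter `¬ Rtd B m (d+1)` is empty, `Cen_d = ⊤`, the admissible
choice `x_t = 1` makes every step `B ↦ k[B ∪ Cen·1⁻¹] = B` the identity (`bddLetters_foldl_fixed`), and
the tower ends where it started; at the `T`-adic valuation of `k'(T)` the end ring `loc O B₀` is the cusp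
`k'[T², T³]_{(T²,T³)}`-like ring of fractions `f/g`, `f'(0) = g'(0) = 0 ≠ g(0)`, which is not regular
(regular ⇒ integrally closed, tree theorem `isIntegrallyClosed_of_isRegularLocalRing`, Matsumura 19.4;
`(T³/T²)² = T²` but `T ∉ loc O B₀` — the argument of `risoCentresResolve_false_without_blowups` over
the base field `k'`, `bddLetters_not_regular`).

Message to provers of the crux: a resolving schedule for a presentation must contain letters `≥` the
dimension of its top-dimensional equisingular product strata (below that dimension the typed `Rtd`
filter removes the WHOLE singular locus and the letter does nothing); in particular the schedule depends
on the presentation at least through such dimensions, and "bounded alphabet" strategies are dead.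
No definitions; kernel-only (propext, Classical.choice, Quot.sound).
-/

set_option linter.dupNamespace false

namespace Summit.ResolutionOfSingularities.ResolutionOfSingularities.Theorems

open Polynomial

set_option maxHeartbeats 1600000 in
/-- **The letters of a resolving schedule cannot be bounded in advance.** The displayed statement is
the crux `RisoStrata.RisoCentresResolve` with `∃ sched : List ℕ, …` weakened to
`∃ sched : List ℕ, (∀ d ∈ sched, d ≤ D) ∧ …` for a bound `D` quantified OUTSIDE the presentation
(everything else verbatim); it is FALSE: on the presentation `h = (1, T², T³, z₀, …, z_D)` of
`k'(T)`, `k' = Frac k[z₀..z_D]` (`cusp × 𝔸^{D+1}`, `k = 𝔽₂^alg`) every maximal ideal of the chart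
`B₀ = k[T², T³, z]` has typed riso-triviality dimension `≥ D+1` (`bddLetters_rtd`), so every letter
`d ≤ D` has `Cen_d = ⊤` and acts as the identity along the admissible choice `x_t = 1`, and the local ring
of `B₀` at the `T`-adic valuation is not regular (`bddLetters_not_regular`). [folklore] -/
theorem risoCentresResolve_false_with_bounded_letters : ¬ (∃ D : ℕ, ∀ p : ℕ, p.Prime → ∀ (k : Type) [Field k] [CharP k p] [IsAlgClosed k] (K : Type) [Field K] [Algebra k K] (N : ℕ) (h : Fin (N + 1) → K), (∀ i, h i ≠ 0) → IntermediateField.adjoin k (Set.range fun ij : Fin (N + 1) × Fin (N + 1) => h ij.1 * (h ij.2)⁻¹) = ⊤ → let Arc : ∀ (B : Subalgebra k K), Ideal ↥B → Type := fun B m => {α : ↥B →ₐ[k] HahnSeries ℚ k // ∀ b ∈ m, 0 < (α b).orderTop}; let Rtd : ∀ (B : Subalgebra k K), Ideal ↥B → ℕ → Prop := fun B m r => ∃ (n : ℕ) (g : Fin n → ↥B), (∀ i, g i ∈ m) ∧ Algebra.adjoin k (Set.range fun i => (g i : K)) = B ∧ ∃ W : Submodule k (Fin n → k), r ≤ Module.finrank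 k ↥W ∧ ∃ φ : Arc B m → (Fin n → HahnSeries ℚ k), (∀ a b : Arc B m, a ≠ b → ∃ j, ∀ i, (a.1 (g j) - b.1 (g j)).orderTop < ((φ a i - φ b i) - (a.1 (g i) - b.1 (g i))).orderTop) ∧ (∀ a i, 0 < (φ a i).orderTop) ∧ (∀ a, ∀ w : Fin n → HahnSeries ℚ k, (∀ i, 0 < (w i).orderTop) → w ∈ Submodule.span (HahnSeries ℚ k) ((fun u : Fin n → k => fun i => HahnSeries.C (u i)) '' (W : Set (Fin n → k))) → ∃ b, φ b = φ a + w); let Cen : ∀ (B : Subalgebra k K), ℕ → Ideal ↥B := fun B d => ⨅ m ∈ {m : Ideal ↥B | ∃ hm : m.IsMaximal, ¬ IsRegularLocalRing (Localization (@Ideal.primeCompl ↥B _ m hm.isPrime)) ∧ ¬ Rtd B m (d + 1)}, m; let step : Subalgebra k K → ℕ → K → Subalgebra k K := fun B d xt => Algebra.adjoin k ((B : Set K) ∪ {y | ∃ a ∈ Cen B d, y = (a : K) * xt⁻¹}); let Valid : ValuationSubring K → Subalgebra k K → ℕ → K → Prop := fun O B d xt => xt ≠ 0 ∧ (∃ x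 ∈ Cen B d, (x : K) = xt) ∧ ∀ a' ∈ Cen B d, (a' : K) * xt⁻¹ ∈ O; let stage : Subalgebra k K → List ℕ → (ℕ → K) → ℕ → Subalgebra k K := fun B₀ sched x t => ((sched.take t).zipIdx).foldl (fun B de => step B de.1 (x de.2)) B₀; let loc : ValuationSubring K → Subalgebra k K → Subalgebra k K := fun O B => Algebra.adjoin k {y | ∃ a ∈ B, ∃ s ∈ B, s⁻¹ ∈ O ∧ y = a * s⁻¹}; ∃ sched : List ℕ, (∀ d ∈ sched, d ≤ D) ∧ ∀ O : ValuationSubring K, (∀ c : k, algebraMap k K c ∈ O) → ∀ j : Fin (N + 1), (∀ i, h i * (h j)⁻¹ ∈ O) → ∀ x : ℕ → K, (∀ t, t < sched.length → Valid O (stage (Algebra.adjoin k (Set.range fun i => h i * (h j)⁻¹)) sched x t) (sched.getD t 0) (x t)) → IsRegularLocalRing ↥(loc O (stage (Algebra.adjoin k (Set.range fun i => h i * (h j)⁻¹)) sched x sched.length))) := by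
  rintro ⟨D, H⟩
  let k : Type := AlgebraicClosure (ZMod 2)
  let R : Type := MvPolynomial (Fin (D + 1)) k
  let k' : Type := FractionRing R
  let K : Type := RatFunc k'
  let T : K := RatFunc.X
  let z : Fin (D + 1) → k' := fun i => algebraMap R k' (MvPolynomial.X i)
  let zK : Fin (D + 1) → K := fun i => algebraMap k' K (z i)
  let zK' : ℕ → K := fun n => if hn : n < D + 1 then zK ⟨n, hn⟩ else 0
  let h : Fin (D + 3 + 1) → K := fun i =>
    if i.val = 0 then 1 else if i.val = 1 then T ^ 2 else if i.val = 2 then T ^ 3 else zK' (i.val - 3)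
  have hT0 : T ≠ 0 := RatFunc.X_ne_zero
  have hT : T = algebraMap k'[X] K Polynomial.X := (RatFunc.algebraMap_X).symm
  have hzK : ∀ i, zK i = algebraMap k'[X] K (Polynomial.C (z i)) := fun i => by
    change algebraMap k' K (z i) = algebraMap k'[X] K (algebraMap k' k'[X] (z i))
    exact IsScalarTower.algebraMap_apply k' k'[X] K _
  have hz0 : ∀ i, zK i ≠ 0 := by
    intro i
    change algebraMap k' K (algebraMap R k' (MvPolynomial.X i)) ≠ 0
    rw [map_ne_zero_iff _ (algebraMap k' K).injective,
      map_ne_zero_iff _ (IsFractionRing.injective R k')]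
    exact MvPolynomial.X_ne_zero i
  -- every value of `h` is `1`, `T²`, `T³` or some `zK j`; the named values
  have hval : ∀ i : Fin (D + 3 + 1), h i =
      (if i.val = 0 then 1 else if i.val = 1 then T ^ 2 else if i.val = 2 then T ^ 3
        else zK' (i.val - 3)) := fun i => rfl
  have hzK'v : ∀ n (hn : n < D + 1), zK' n = zK ⟨n, hn⟩ := fun n hn => dif_pos hn
  have h0 : h 0 = 1 := by rw [hval]; exact if_pos rfl
  have h1 : h 1 = T ^ 2 := by
    rw [hval]
    have e : (1 : Fin (D + 3 + 1)).val = 1 := rfl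
    rw [if_neg (by rw [e]; decide), if_pos e]
  have h2 : h 2 = T ^ 3 := by
    rw [hval]
    have e : (2 : Fin (D + 3 + 1)).val = 2 := rfl
    rw [if_neg (by rw [e]; decide), if_neg (by rw [e]; decide), if_pos e]
  have h3 : ∀ j : Fin (D + 1), h ⟨j.val + 3, by have := j.isLt; omega⟩ = zK j := by
    intro j
    rw [hval]
    dsimp only
    rw [if_neg (by omega), if_neg (by omega), if_neg (by omega), hzK'v _ (by omega)]
    congr 1
  have hcases : ∀ i, h i = 1 ∨ h i = T ^ 2 ∨ h i = T ^ 3 ∨ ∃ j, h i = zK j := by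
    intro i
    rw [hval]
    split_ifs with h0' h1' h2'
    · exact Or.inl rfl
    · exact Or.inr (Or.inl rfl)
    · exact Or.inr (Or.inr (Or.inl rfl))
    · have hi : i.val - 3 < D + 1 := by have := i.isLt; omega
      exact Or.inr (Or.inr (Or.inr ⟨⟨i.val - 3, hi⟩, hzK'v _ hi⟩))
  have hh0 : ∀ i, h i ≠ 0 := by
    intro i
    rcases hcases i with e | e | e | ⟨j, e⟩ <;> rw [e]
    · exact one_ne_zero
    · exact pow_ne_zero 2 hT0
    · exact pow_ne_zero 3 hT0
    · exact hz0 j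
  -- the ratios generate `K` as a field over `k`
  have hgen : IntermediateField.adjoin k
      (Set.range fun ij : Fin (D + 3 + 1) × Fin (D + 3 + 1) => h ij.1 * (h ij.2)⁻¹) = ⊤ := by
    set F := IntermediateField.adjoin k
      (Set.range fun ij : Fin (D + 3 + 1) × Fin (D + 3 + 1) => h ij.1 * (h ij.2)⁻¹) with hF
    have hTF : T ∈ F := by
      have hm : h 2 * (h 1)⁻¹ ∈ F :=
        IntermediateField.subset_adjoin k _ ⟨((2 : Fin (D + 3 + 1)), (1 : Fin (D + 3 + 1))), rfl⟩
      have e : h 2 * (h 1)⁻¹ = T := by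
        rw [h2, h1, pow_succ, mul_comm (T ^ 2) T, mul_inv_cancel_right₀ (pow_ne_zero 2 hT0)]
      exact e ▸ hm
    have hzF : ∀ j, zK j ∈ F := by
      intro j
      have hm : h ⟨j.val + 3, by have := j.isLt; omega⟩ * (h 0)⁻¹ ∈ F :=
        IntermediateField.subset_adjoin k _ ⟨((⟨j.val + 3, by have := j.isLt; omega⟩ : Fin (D + 3 + 1)),
          (0 : Fin (D + 3 + 1))), rfl⟩
      have e : h ⟨j.val + 3, by have := j.isLt; omega⟩ * (h 0)⁻¹ = zK j := by
        rw [h3, h0, inv_one, mul_one]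
      exact e ▸ hm
    -- `k'` maps into `F`
    have hRF : ∀ q : R, algebraMap k' K (algebraMap R k' q) ∈ F := by
      intro q
      induction q using MvPolynomial.induction_on with
      | C c =>
        have : algebraMap k' K (algebraMap R k' (MvPolynomial.C c)) = algebraMap k K c := by
          change algebraMap k' K (algebraMap R k' (algebraMap k R c)) = algebraMap k K c
          rw [← IsScalarTower.algebraMap_apply k R k', ← IsScalarTower.algebraMap_apply k k' K]
        rw [this]; exact F.algebraMap_mem c
      | add p q hp hq => rw [map_add, map_add]; exact add_mem hp hq
      | mul_X p i hp => rw [map_mul, map_mul]; exact mul_mem hp (hzF i)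
    have hk'F : ∀ c : k', algebraMap k' K c ∈ F := by
      intro c
      obtain ⟨a, b, hb, rfl⟩ := IsFractionRing.div_surjective (A := R) c
      rw [map_div₀]
      exact div_mem (hRF a) (hRF b)
    have hpolyF : ∀ f : k'[X], algebraMap k'[X] K f ∈ F := by
      intro f
      induction f using Polynomial.induction_on' with
      | add p q hp hq => rw [map_add]; exact add_mem hp hq
      | monomial n c =>
        rw [← Polynomial.C_mul_X_pow_eq_monomial, map_mul, map_pow, ← hT]
        have hc : algebraMap k'[X] K (Polynomial.C c) = algebraMap k' K c := by
          change algebraMap k'[X] K (algebraMap k' k'[X] c) = algebraMap k' K c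
          exact (IsScalarTower.algebraMap_apply k' k'[X] K c).symm
        rw [hc]
        exact mul_mem (hk'F c) (pow_mem hTF n)
    rw [eq_top_iff]
    intro f _
    rw [← RatFunc.num_div_denom f]
    exact div_mem (hpolyF _) (hpolyF _)
  -- the `X`-adic valuation ring of `k'(X)`
  let v := (Polynomial.idealX k').valuation K
  let O : ValuationSubring K := v.valuationSubring
  have hOpoly : ∀ r : k'[X], algebraMap k'[X] K r ∈ O := fun r =>
    (Valuation.mem_valuationSubring_iff v _).mpr (IsDedekindDomain.HeightOneSpectrum.valuation_le_one _ r)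
  have hOk : ∀ c : k, algebraMap k K c ∈ O := by
    intro c
    rw [IsScalarTower.algebraMap_apply k k'[X] K]
    exact hOpoly _
  have hmemO : ∀ i, h i ∈ O := by
    intro i
    rcases hcases i with e | e | e | ⟨j, e⟩ <;> rw [e]
    · exact one_mem O
    · rw [hT, ← map_pow]; exact hOpoly _
    · rw [hT, ← map_pow]; exact hOpoly _
    · rw [hzK]; exact hOpoly _
  have hchart : ∀ i, h i * (h 0)⁻¹ ∈ O := by
    intro i
    rw [h0, inv_one, mul_one]
    exact hmemO i
  obtain ⟨sched, hbd, Hres⟩ := H 2 Nat.prime_two k K (D + 3) h hh0 hgen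
  have Hres0 := Hres O hOk 0 hchart
  clear Hres H
  set B₀ : Subalgebra k K := Algebra.adjoin k (Set.range fun i => h i * (h 0)⁻¹) with hB₀
  -- `B₀ = k[T², T³, z]`
  have hB₀eq : B₀ = Algebra.adjoin k (insert (T ^ 2) (insert (T ^ 3) (Set.range zK))) := by
    rw [hB₀]
    apply le_antisymm
    · refine Algebra.adjoin_le ?_
      rintro _ ⟨i, rfl⟩
      beta_reduce
      rw [h0, inv_one, mul_one]
      rcases hcases i with e | e | e | ⟨j, e⟩ <;> rw [e]
      · exact one_mem _
      · exact Algebra.subset_adjoin (Set.mem_insert _ _)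
      · exact Algebra.subset_adjoin (Set.mem_insert_of_mem _ (Set.mem_insert _ _))
      · exact Algebra.subset_adjoin (Set.mem_insert_of_mem _ (Set.mem_insert_of_mem _ ⟨j, rfl⟩))
    · refine Algebra.adjoin_le ?_
      rintro y (rfl | rfl | ⟨j, rfl⟩)
      · refine Algebra.subset_adjoin ⟨1, ?_⟩
        change h 1 * (h 0)⁻¹ = T ^ 2
        rw [h1, h0, inv_one, mul_one]
      · refine Algebra.subset_adjoin ⟨2, ?_⟩
        change h 2 * (h 0)⁻¹ = T ^ 3
        rw [h2, h0, inv_one, mul_one]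
      · refine Algebra.subset_adjoin ⟨⟨j.val + 3, by have := j.isLt; omega⟩, ?_⟩
        change h ⟨j.val + 3, _⟩ * (h 0)⁻¹ = zK j
        rw [h3, h0, inv_one, mul_one]
  have hB₀O : ∀ y ∈ B₀, y ∈ O := by
    let OA : Subalgebra k K := { O.toSubring with algebraMap_mem' := hOk }
    have : B₀ ≤ OA := by
      rw [hB₀]
      refine Algebra.adjoin_le ?_
      rintro _ ⟨i, rfl⟩
      exact hchart i
    exact fun y hy => this hy
  -- `B₀` consists of polynomials `f ∈ k'[X]` with `f'(0) = 0`
  have hB₀M : ∀ a ∈ B₀, ∃ f : k'[X], (derivative f).coeff 0 = 0 ∧ a = algebraMap k'[X] K f := by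
    let M₁ : Subalgebra k K :=
      { carrier := {a | ∃ f : k'[X], (derivative f).coeff 0 = 0 ∧ a = algebraMap k'[X] K f}
        mul_mem' := by
          rintro _ _ ⟨f, hf, rfl⟩ ⟨g, hg, rfl⟩
          exact ⟨f * g, by rw [bddLetters_D_mul, hf, hg]; ring, (map_mul _ _ _).symm⟩
        add_mem' := by
          rintro _ _ ⟨f, hf, rfl⟩ ⟨g, hg, rfl⟩
          refine ⟨f + g, ?_, (map_add _ _ _).symm⟩
          rw [derivative_add, coeff_add, hf, hg, add_zero]
        algebraMap_mem' := fun c => ⟨C (algebraMap k k' c), by simp, by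
          rw [IsScalarTower.algebraMap_apply k k'[X] K, Polynomial.algebraMap_apply]⟩ }
    have hle : B₀ ≤ M₁ := by
      rw [hB₀eq]
      refine Algebra.adjoin_le ?_
      rintro y (rfl | rfl | ⟨j, rfl⟩)
      · exact ⟨X ^ 2, bddLetters_D_X_pow 2 le_rfl, by rw [map_pow, ← hT]⟩
      · exact ⟨X ^ 3, bddLetters_D_X_pow 3 (by norm_num), by rw [map_pow, ← hT]⟩
      · exact ⟨Polynomial.C (z j), by simp, hzK j⟩
    exact fun a ha => hle ha
  have hT2 : T ^ 2 ∈ B₀ := hB₀eq ▸ Algebra.subset_adjoin (Set.mem_insert _ _)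
  have hT3 : T ^ 3 ∈ B₀ := hB₀eq ▸ Algebra.subset_adjoin (Set.mem_insert_of_mem _ (Set.mem_insert _ _))
  -- algebraic independence of `T, z₀, …, z_D`
  have hind : Function.Injective
      (MvPolynomial.aeval (Fin.cons T zK : Fin (D + 2) → K) : MvPolynomial (Fin (D + 2)) k →ₐ[k] K) := by
    let φ1 := MvPolynomial.finSuccEquiv k (D + 1)
    let φ2 : Polynomial R →+* Polynomial k' := Polynomial.mapRingHom (algebraMap R k')
    let φ3 : Polynomial k' →+* K := algebraMap k'[X] K
    have hφ2 : Function.Injective φ2 := Polynomial.map_injective _ (IsFractionRing.injective R k')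
    have hcomp : (MvPolynomial.aeval (Fin.cons T zK : Fin (D + 2) → K) :
        MvPolynomial (Fin (D + 2)) k →ₐ[k] K).toRingHom = φ3.comp (φ2.comp φ1.toRingHom) := by
      refine MvPolynomial.ringHom_ext (fun c => ?_) (fun i => ?_)
      · change MvPolynomial.aeval (Fin.cons T zK : Fin (D + 2) → K) (MvPolynomial.C c) =
          φ3 (φ2 (φ1 (MvPolynomial.C c)))
        rw [MvPolynomial.algHom_C, MvPolynomial.finSuccEquiv_apply, MvPolynomial.eval₂Hom_C]
        change algebraMap k K c = algebraMap k'[X] K (Polynomial.map (algebraMap R k')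
          (Polynomial.C (MvPolynomial.C c)))
        rw [Polynomial.map_C]
        change algebraMap k K c = algebraMap k'[X] K (algebraMap k' k'[X] (algebraMap R k' (algebraMap k R c)))
        rw [← IsScalarTower.algebraMap_apply k R k', ← IsScalarTower.algebraMap_apply k k' k'[X],
          ← IsScalarTower.algebraMap_apply k k'[X] K]
      · change MvPolynomial.aeval (Fin.cons T zK : Fin (D + 2) → K) (MvPolynomial.X i) =
          φ3 (φ2 (φ1 (MvPolynomial.X i)))
        rw [MvPolynomial.aeval_X]
        refine Fin.cases ?_ (fun j => ?_) i
        · rw [Fin.cons_zero]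
          change T = algebraMap k'[X] K (Polynomial.map (algebraMap R k')
            (MvPolynomial.finSuccEquiv k (D + 1) (MvPolynomial.X 0)))
          rw [MvPolynomial.finSuccEquiv_X_zero, Polynomial.map_X, ← hT]
        · rw [Fin.cons_succ]
          change zK j = algebraMap k'[X] K (Polynomial.map (algebraMap R k')
            (MvPolynomial.finSuccEquiv k (D + 1) (MvPolynomial.X j.succ)))
          rw [MvPolynomial.finSuccEquiv_X_succ, Polynomial.map_C, hzK]
    have hfun : ⇑(MvPolynomial.aeval (Fin.cons T zK : Fin (D + 2) → K) :
        MvPolynomial (Fin (D + 2)) k →ₐ[k] K) = ⇑φ3 ∘ ⇑φ2 ∘ ⇑φ1 := by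
      have := congrArg (fun f : MvPolynomial (Fin (D + 2)) k →+* K => ⇑f) hcomp
      simpa using this
    rw [hfun]
    exact (IsFractionRing.injective k'[X] K).comp (hφ2.comp φ1.injective)
  -- run the tower with `x_t = 1`: all letters are inert, the end ring is `loc O B₀`
  have hreg0 := Hres0 (fun _ => (1 : K)) (by
    intro t ht
    have hdD : sched.getD t 0 + 1 ≤ D + 1 := by
      have hmem : sched.getD t 0 ∈ sched := by
        rw [List.getD_eq_getElem _ _ ht]
        exact List.getElem_mem ht
      have := hbd _ hmem
      omega
    beta_reduce
    rw [bddLetters_foldl_fixed]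
    · refine ⟨one_ne_zero, ⟨1, ?_, rfl⟩, fun a' _ => ?_⟩
      · refine (Submodule.mem_iInf _).mpr fun m => (Submodule.mem_iInf _).mpr fun hm => ?_
        obtain ⟨hmax, -, hnRtd⟩ := hm
        exact absurd (bddLetters_rtd T zK hind B₀ hB₀eq m hmax _ hdD) hnRtd
      · rw [inv_one, mul_one]
        exact hB₀O _ a'.2
    · rintro B de y ⟨a, -, rfl⟩
      rw [inv_one, mul_one]
      exact a.2)
  beta_reduce at hreg0
  rw [bddLetters_foldl_fixed] at hreg0
  · exact bddLetters_not_regular B₀ hB₀M hT2 hT3 hreg0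
  · rintro B de y ⟨a, -, rfl⟩
    rw [inv_one, mul_one]
    exact a.2

/-- **No universal word.** For every FIXED schedule `s`, the crux `RisoStrata.RisoCentresResolve` with
its existential `∃ sched : List ℕ,` replaced by `let sched : List ℕ := s;` (everything else verbatim)
is FALSE — the schedule must depend on the presentation: by
`risoCentresResolve_false_with_bounded_letters` with `D = s.sum`, the presentation `cusp × 𝔸^{D+1}`
makes every letter of `s` inert.  The case `s = []` is `risoCentresResolve_false_without_blowups`.
[folklore] -/
theorem risoCentresResolve_false_with_fixed_schedule (s : List ℕ) : ¬ (∀ p : ℕ, p.Prime → ∀ (k : Type) [Field k] [CharP k p] [IsAlgClosed k] (K : Type) [Field K] [Algebra k K] (N : ℕ) (h : Fin (N + 1) → K), (∀ i, h i ≠ 0) → IntermediateField.adjoin k (Set.range fun ij : Fin (N + 1) × Fin (N + 1) => h ij.1 * (h ij.2)⁻¹) = ⊤ → let Arc : ∀ (B : Subalgebra k K), Ideal ↥B → Type := fun B m => {α : ↥B →ₐ[k] HahnSeries ℚ k // ∀ b ∈ m, 0 < (α b).orderTop}; let Rtd : ∀ (B : Subalgebra k K), Ideal ↥B → ℕ →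 Prop := fun B m r => ∃ (n : ℕ) (g : Fin n → ↥B), (∀ i, g i ∈ m) ∧ Algebra.adjoin k (Set.range fun i => (g i : K)) = B ∧ ∃ W : Submodule k (Fin n → k), r ≤ Module.finrank k ↥W ∧ ∃ φ : Arc B m → (Fin n → HahnSeries ℚ k), (∀ a b : Arc B m, a ≠ b → ∃ j, ∀ i, (a.1 (g j) - b.1 (g j)).orderTop < ((φ a i - φ b i) - (a.1 (g i) - b.1 (g i))).orderTop) ∧ (∀ a i, 0 < (φ a i).orderTop) ∧ (∀ a, ∀ w : Fin n → HahnSeries ℚ k, (∀ i, 0 < (w i).orderTop) → w ∈ Submodule.span (HahnSeries ℚ k) ((fun u : Fin n → k => fun i => HahnSeries.C (u i)) '' (W : Set (Fin n → k))) → ∃ b, φ b = φ a + w); let Cen : ∀ (B : Subalgebra k K), ℕ → Ideal ↥B := fun B d => ⨅ m ∈ {m : Ideal ↥B | ∃ hm : m.IsMaximal, ¬ IsRegularLocalRing (Localization (@Ideal.primeCompl ↥B _ m hm.isPrime)) ∧ ¬ Rtd B m (d + 1)}, m; let step : Subalgebra k K → ℕ → K → Subalgebra k K := fun B d xt => Algebra.adjoin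 k ((B : Set K) ∪ {y | ∃ a ∈ Cen B d, y = (a : K) * xt⁻¹}); let Valid : ValuationSubring K → Subalgebra k K → ℕ → K → Prop := fun O B d xt => xt ≠ 0 ∧ (∃ x ∈ Cen B d, (x : K) = xt) ∧ ∀ a' ∈ Cen B d, (a' : K) * xt⁻¹ ∈ O; let stage : Subalgebra k K → List ℕ → (ℕ → K) → ℕ → Subalgebra k K := fun B₀ sched x t => ((sched.take t).zipIdx).foldl (fun B de => step B de.1 (x de.2)) B₀; let loc : ValuationSubring K → Subalgebra k K → Subalgebra k K := fun O B => Algebra.adjoin k {y | ∃ a ∈ B, ∃ s ∈ B, s⁻¹ ∈ O ∧ y = a * s⁻¹}; let sched : List ℕ := s; ∀ O : ValuationSubring K, (∀ c : k, algebraMap k K c ∈ O) → ∀ j : Fin (N + 1), (∀ i, h i * (h j)⁻¹ ∈ O) → ∀ x : ℕ → K, (∀ t, t < sched.length → Valid O (stage (Algebra.adjoin k (Set.range fun i => h i * (h j)⁻¹)) sched x t) (sched.getD t 0) (x t)) → IsRegularLocalRing ↥(loc O (stage (Algebra.adjoin k (Set.range fun i => h i * (h j)⁻¹)) sched x sched.length)))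 := by
  intro H
  apply risoCentresResolve_false_with_bounded_letters
  refine ⟨s.sum, fun p hp k _ _ _ K _ _ N h hh hgen => ?_⟩
  have HH := H p hp k K N h hh hgen
  dsimp only at HH ⊢
  exact ⟨s, fun d hd => List.le_sum_of_mem hd, HH⟩

end Summit.ResolutionOfSingularities.ResolutionOfSingularities.Theorems
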